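import Summits.CriticalPhenomena.PercolationContinuityZ3.Theses.PercNearOneGluingNoHeavy
import Summits.CriticalPhenomena.PercolationContinuityZ3.Theses.PercNearOneGluing
import Summits.CriticalPhenomena.PercolationContinuityZ3.Theorems.PercNearOneGluingNoHeavyLowerTailReduction
import Summits.CriticalPhenomena.PercolationContinuityZ3.Theorems.PercNearOneGluingNoHeavyLowerTailResidualOfNearOneGluing
import Summits.CriticalPhenomena.PercolationContinuityZ3.Theorems.PercNearOneGluingAdditiveGluingSuffices
import Summits.CriticalPhenomena.PercolationContinuityZ3.Theorems.PercNearOneGluingAdditiveGluingSurplusClosure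
import HarnessLib

/-!
# `NoHeavyLowerTail` from the additive gluing engine / from the surplus-transfer inequality (S5)

The statement `NoHeavyLowerTail` (declared identically in the namespaces `PercNearOneGluingNoHeavy` and
`PercNearOneGluing`; the two declarations are definitionally equal) is equivalent to Kozma–Nitzan's Conjecture 3
`NearOneGluing`.  This file composes the implications
`(S5) for non-degenerate weights ⟹ AdditiveGluing` (`CSH.additiveGluing_of_surplusTransfer_nondegenerate`),
`AdditiveGluing ⟹ NearOneGluing` (`additiveGluingSuffices_proof`),
`NearOneGluing ⟹ many-finger large-pocket residual` (`manyFingersLargePocket_of_nearOneGluing`),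
`residual ⟹ NoHeavyLowerTail` (`noHeavyLowerTail_of_manyFingersLargePocket`)
into three one-step reductions of `NoHeavyLowerTail`: once `0 ≤ CSH.s5dMargin p T r [] o v F` is proved for non-degenerate `p`
and the degenerate observers are handled (which gives `AdditiveGluing`, `CSH.additiveGluing_holds`),
`noHeavyLowerTail_of_additiveGluing` yields `NoHeavyLowerTail` in one line.
[cite: KozmaNitzan2024, Conj. 1 (p. 3), Conj. 3 (p. 15), Conj. 4 (p. 32)] [cite: HarrisPCPS1960]
-/

noncomputable section

namespace Summit.CriticalPhenomena.PercolationContinuityZ3.Theorems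

open MeasureTheory Set
open Literature.Probability.LatticeModels (prodBernoulli)
open Literature.Probability.Percolation
open scoped Classical

/-- **KN Conjecture 3 ⟹ the lower-tail engine**: `NearOneGluing → NoHeavyLowerTail` (namespace `PercNearOneGluingNoHeavy`),
by the chain `NearOneGluing ⟹ many-finger large-pocket residual ⟹ NoHeavyLowerTail`.
[cite: KozmaNitzan2024, Conj. 3 (p. 15)] -/
theorem noHeavyLowerTail_of_nearOneGluing
    (hX : Summit.CriticalPhenomena.PercolationContinuityZ3.Theses.PercNearOneGluingNoHeavy.NearOneGluing) :
    Summit.CriticalPhenomena.PercolationContinuityZ3.Theses.PercNearOneGluingNoHeavy.NoHeavyLowerTail :=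
  noHeavyLowerTail_of_manyFingersLargePocket (manyFingersLargePocket_of_nearOneGluing hX)

/-- **The additive gluing engine ⟹ the lower-tail engine**: `AdditiveGluing → NoHeavyLowerTail`
(`AdditiveGluing` of namespace `PercNearOneGluing`; `NoHeavyLowerTail` of namespace `PercNearOneGluingNoHeavy`).
[cite: KozmaNitzan2024, Conj. 1 (p. 3), Conj. 3 (p. 15)] -/
theorem noHeavyLowerTail_of_additiveGluing
    (hA : Summit.CriticalPhenomena.PercolationContinuityZ3.Theses.PercNearOneGluing.AdditiveGluing) :
    Summit.CriticalPhenomena.PercolationContinuityZ3.Theses.PercNearOneGluingNoHeavy.NoHeavyLowerTail :=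
  noHeavyLowerTail_of_nearOneGluing (additiveGluingSuffices_proof hA)

/-- **(S5) for non-degenerate weights ⟹ the lower-tail engine.**  If the surplus-transfer inequality
`μ_p(v ↮ T, o ↔ v)·Sur_v(T) ≤ μ_p(v ↮ T)·Sur_o(T)` (Kozma–Nitzan's Conjecture-4 shape, the hypothesis `hS5` of
`AGloc.additiveGluing_of_surplusTransfer`) holds for every NON-DEGENERATE weight function (all pair probabilities in `(0,1)`),
every relay set `T ∌ v`, every monotone `F ≥ 0` and every injective `m(p)`-compatible rank, then `NoHeavyLowerTail` holds.
[cite: KozmaNitzan2024, Conj. 4 (p. 32)] -/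
theorem noHeavyLowerTail_of_surplusTransfer_nondegenerate
    (hS5 : ∀ (n : ℕ) (p : Sym2 (Fin n) → unitInterval), (∀ e, 0 < p e ∧ p e < 1) →
      ∀ (T : Finset (Fin n)) (o v : Fin n) (F : Set (Fin n) → ℝ) (r : Fin n → ℕ),
      v ∉ T → (∀ S S' : Set (Fin n), S ⊆ S' → F S ≤ F S') → (∀ S, 0 ≤ F S) → Set.InjOn r ↑T →
      (∀ a ∈ T, ∀ a' ∈ T, r a < r a' →
        ∫ ω, F (openCluster ω a) ∂(prodBernoulli p) ≤ ∫ ω, F (openCluster ω a') ∂(prodBernoulli p)) →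
      (prodBernoulli p).real ({ω : BondConfig (Fin n) | ∀ a ∈ T, ¬ (openGraph ω).Reachable v a} ∩ openConn o v) *
          CSH.surplus p T r F v ≤
        (prodBernoulli p).real {ω : BondConfig (Fin n) | ∀ a ∈ T, ¬ (openGraph ω).Reachable v a} * CSH.surplus p T r F o) :
    Summit.CriticalPhenomena.PercolationContinuityZ3.Theses.PercNearOneGluingNoHeavy.NoHeavyLowerTail :=
  noHeavyLowerTail_of_additiveGluing (CSH.additiveGluing_of_surplusTransfer_nondegenerate hS5)

end Summit.CriticalPhenomena.PercolationContinuityZ3.Theorems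

end
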